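import Summits.BirchSwinnertonDyer.BirchSwinnertonDyer.Theorems.QuadraticBranchSignedControlPlusEtaNonsurjCartanMatrix
import Literature.NumberTheory.EllipticCurves.TateCurve.NumberFieldUniformizationTwisted
import Literature.NumberTheory.EllipticCurves.TateCurve.TorsionGaloisModule
import Literature.NumberTheory.EllipticCurves.HasseWeilGoodReductionFrobeniusProofs
import Literature.NumberTheory.EllipticCurves.NeronOggShafarevichLocal
import Literature.NumberTheory.EllipticCurves.LFunctionPrimeCoeff
import Literature.NumberTheory.GaloisRepresentations.ModNCyclotomicCharacter
import HarnessLib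

/-!
# Route `QuadraticBranchSignedControl` (rung K8, cell `bsd-potss`): crux stmt-BirchSwinnertonDyer-19606
# `PlusEtaMainConjectureNonsurj` — FROBENIUS AT A MULTIPLICATIVE PRIME ON `E[p]`: a rational eigenvector of
# eigenvalue `± ℓ` (Tate), and the `C_ns⁺(ε)` matrix algebra it feeds (part 1 of «multiplicative primes `≡ ±1 mod p`»)

WHAT. First half of the kernel form of FINDING-19606-k8eta-c2-g11 §2e («all 368 multiplicative primes `ℓ` of the 336
rows of the height-20 `X_ns⁺(5)` table are `≡ ±1 (mod 5)`, `≡ +1` iff split in `K_V`»); the row theorems are in the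
companion file `…PlusEtaNonsurjMultiplicativeCongruence`. Two route-free inputs:

* §1 MATRIX ALGEBRA in `C_ns⁺(ε)` (`ε` a non-square of `𝔽_p`): a matrix `M` with a RATIONAL eigenvector of eigenvalue
  `s ℓ` (`s² = 1`) and `det M = ℓ ≠ 0` has `ℓ = 1` if `M ∈ C_ns(ε)` (the eigenvalues `a ± b√ε` of `(a, εb; b, a)` are
  rational only if `b = 0`, so `M = s ℓ` is scalar with square `ℓ`: `ℓ² = ℓ`) — `eq_one_of_mem_nonsplitCartan_of_mulVec_eq`
  — and `ℓ = −1` if `M ∉ C_ns(ε)` (then `M = (c, −εd; d, −c)`, `M² = −det M`, so `ℓ² x = M² x = −ℓ x`) —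
  `eq_neg_one_of_not_mem_nonsplitCartan_of_mulVec_eq`.
* §2 THE TATE INPUT over `ℚ` (any elliptic `W/ℚ`, any place `v` of multiplicative reduction, `char v = ℓ ≠ p`): by
  Tate's uniformisation TWISTED by the unramified quadratic character `χ` of `ℚ_ℓ(√γ)/ℚ_ℓ` (Silverman, *ATAEC* V.5.2 (c),
  V.5.3, V.5.4 — the tree's THEOREM `TateCurve.Silverman1994_thmV53_corV54_tateUniformisation_holds`:
  `σ • Ψ(u) = χ(σ) Ψ(σ u)`, kernel `q^ℤ`) the image `Ψ(ζ_p)` of a primitive `p`-th root of unity is a NON-ZERO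
  `p`-torsion point on which `τ ∈ Γ_{ℚ_ℓ}` acts by `χ(τ)·χ_p(τ)`. For a local arithmetic Frobenius `τ` the restriction
  `σ₁ = τ|_{ℚ̄}` (`resGalOfEmb`) is an arithmetic Frobenius at the prime `𝔓_{ι,𝔐} ∣ ℓ` of `ℤ̄`
  (`isArithFrobAt_resGalOfEmb`), so `χ_p(σ₁) = ℓ` (`modNCyclotomicCharacter_resGalOfEmb_eq_of_isArithFrobAt`, from
  `modNCyclotomicCharacter_eq_residueCard_of_isArithFrobAt`), and transporting `Ψ(ζ_p)` to `W(ℚ̄)`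
  (`exists_pointsMapOfEmb_eq_of_nsmul_eq_zero`, `pointsMapOfEmb_smul`) gives
  **`exists_eigenvector_resGalOfEmb_of_hasMultiplicativeReductionAt`: a non-zero `P ∈ W[p]` with `σ₁ • P = (± ℓ) • P`.**

HONEST FRAMING (cell `bsd-potss`, run/shared/lean/pub/bsd-potss/; FULL-BSD rank ≤ 1 programme): TOOL THEOREMS ONLY
(no definition, no named fact, no `sorry`, axioms standard). Nothing is booked; crux 19606 stays OPEN; `BSD(W, p)` is
claimed for no pair. Seat `bsd-potss-k8eta-c2` g12 (prover), `--supports stmt-BirchSwinnertonDyer-19606`.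

References: [SilvermanATAEC1994] Lemma V.5.2 (c), Thm. V.5.3, Cor. V.5.4 (PDF pp. 406–410), Thm. V.3.1 (c),(d);
[Serre1972] §2.2 (`C_ns⁺`), §1.11–1.12 (Tate curve and `χ_p` on `E[p]` at a multiplicative place);
[NeukirchANT1999] Ch. I (10.3), Ch. II (9.6) (Frobenius and its restriction).
-/

set_option autoImplicit false
set_option linter.dupNamespace false

noncomputable section

open scoped Classical NNReal

open Matrix Field IsDedekindDomain NumberField WeierstrassCurve Literature.NumberTheory.EllipticCurves
  Literature.NumberTheory.GaloisRepresentations Literature.NumberTheory.SerreUniformity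
  Rat.HeightOneSpectrum IsDedekindDomain.HeightOneSpectrum

namespace Summit.BirchSwinnertonDyer.BirchSwinnertonDyer.Theorems.EtaCartanField

/-! ## §1 Matrix algebra in `C_ns⁺(ε)`: a rational eigenvector of eigenvalue `s ℓ` with `det = ℓ` -/

section MatrixAlgebra

variable {p : ℕ} [hp : Fact p.Prime]

/-- **Cartan case.** If `M = (a, εb; b, a) ∈ C_ns(ε)` (`ε` a non-square) has a non-zero vector `x` with
`M x = (s ℓ) x`, `s² = 1`, and `det M = ℓ ≠ 0`, then `ℓ = 1`: a rational eigenvalue forces `b = 0`, so `M = a`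
is scalar with `a = s ℓ` and `a² = ℓ`, i.e. `ℓ² = ℓ`. [cite: Serre1972, §2.2] -/
theorem eq_one_of_mem_nonsplitCartan_of_mulVec_eq {ε : ZMod p} (hε : ¬ IsSquare ε)
    {M : Matrix (Fin 2) (Fin 2) (ZMod p)} (hM : M ∈ nonsplitCartan ε) {x : Fin 2 → ZMod p} (hx : x ≠ 0)
    {s l : ZMod p} (hs : s ^ 2 = 1) (hMx : M *ᵥ x = (s * l) • x) (hdet : M.det = l) (hl : l ≠ 0) :
    l = 1 := by
  obtain ⟨a, b, -, rfl⟩ := hM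
  have h1 : a * x 0 + ε * b * x 1 = s * l * x 0 := by
    have := congrFun hMx 0
    simpa [Matrix.mulVec, dotProduct, Fin.sum_univ_two, mul_assoc] using this
  have h2 : b * x 0 + a * x 1 = s * l * x 1 := by
    have := congrFun hMx 1
    simpa [Matrix.mulVec, dotProduct, Fin.sum_univ_two] using this
  rw [Matrix.det_fin_two_of] at hdet
  -- `b = 0`: otherwise `ε` is a square
  have hb : b = 0 := by
    by_contra hb
    apply hε
    -- from `h2`: `x 0 = (s l - a) x 1 / b`; substitute in `h1`
    have hx1 : x 1 ≠ 0 := by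
      intro hx1
      rw [hx1, mul_zero, mul_zero, add_zero] at h2
      have hx0 : x 0 = 0 := by
        rcases mul_eq_zero.mp h2 with h | h
        · exact absurd h hb
        · exact h
      exact hx (funext fun i => by fin_cases i <;> assumption)
    refine ⟨(s * l - a) / b, ?_⟩
    have key : ε * b * x 1 * b = (s * l - a) * ((s * l - a) * x 1) := by
      have e0 : b * x 0 = (s * l - a) * x 1 := by linear_combination h2
      have e1 : ε * b * x 1 = (s * l - a) * x 0 := by linear_combination h1
      calc ε * b * x 1 * b = (s * l - a) * (b * x 0) := by rw [e1]; ring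
        _ = (s * l - a) * ((s * l - a) * x 1) := by rw [e0]
    field_simp
    have := mul_right_cancel₀ hx1 (show ε * b * b * x 1 = (s * l - a) * (s * l - a) * x 1 by
      linear_combination key)
    linear_combination this
  subst hb
  -- `M = a`, `a = s l`, `a² = l`
  have ha : a = s * l := by
    by_cases hx0 : x 0 = 0
    · have hx1 : x 1 ≠ 0 := fun hx1 => hx (funext fun i => by fin_cases i <;> assumption)
      rw [zero_mul, zero_add] at h2
      exact mul_right_cancel₀ hx1 h2
    · rw [mul_zero, zero_mul, add_zero] at h1
      exact mul_right_cancel₀ hx0 h1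
  have hdet' : a * a = l := by linear_combination hdet
  rw [ha] at hdet'
  have hll : l * l = l := by
    calc l * l = s ^ 2 * (l * l) := by rw [hs, one_mul]
      _ = s * l * (s * l) := by ring
      _ = l := hdet'
  have := mul_right_cancel₀ hl (hll.trans (one_mul l).symm)
  exact this

/-- **Coset case.** If `M ∈ C_ns⁺(ε) ∖ C_ns(ε)` — so `M = (c, −εd; d, −c)`, `tr M = 0`, `M² = −det M` — has a
non-zero vector `x` with `M x = (s ℓ) x`, `s² = 1`, and `det M = ℓ ≠ 0`, then `ℓ = −1` (`ℓ² x = M² x = −ℓ x`).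
[cite: Serre1972, §2.2] -/
theorem eq_neg_one_of_not_mem_nonsplitCartan_of_mulVec_eq {ε : ZMod p}
    {M : Matrix (Fin 2) (Fin 2) (ZMod p)} (hM : M ∈ nonsplitCartanNormalizer ε) (hM' : M ∉ nonsplitCartan ε)
    {x : Fin 2 → ZMod p} (hx : x ≠ 0) {s l : ZMod p} (hs : s ^ 2 = 1) (hMx : M *ᵥ x = (s * l) • x)
    (hdet : M.det = l) (hl : l ≠ 0) : l = -1 := by
  obtain ⟨c, d, -, rfl⟩ := exists_eq_coset_of_not_mem_nonsplitCartan hM hM'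
  rw [Matrix.det_fin_two_of] at hdet
  have h1 : c * x 0 + -(ε * d) * x 1 = s * l * x 0 := by
    have := congrFun hMx 0
    simpa [Matrix.mulVec, dotProduct, Fin.sum_univ_two] using this
  have h2 : d * x 0 + -c * x 1 = s * l * x 1 := by
    have := congrFun hMx 1
    simpa [Matrix.mulVec, dotProduct, Fin.sum_univ_two] using this
  -- `M² x = (c² - ε d²) x = -l x` and `M² x = (s l)² x = l² x`
  have hd : c * c - ε * d * d = -l := by linear_combination -hdet
  have hsq0 : (l * l + l) * x 0 = 0 := by
    have e' : (c * c - ε * d * d) * x 0 = s * l * (s * l) * x 0 := by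
      linear_combination (c + s * l) * h1 - ε * d * h2
    rw [hd] at e'
    linear_combination (-1 : ZMod p) * e' - l * l * x 0 * hs
  have hsq1 : (l * l + l) * x 1 = 0 := by
    have e' : (c * c - ε * d * d) * x 1 = s * l * (s * l) * x 1 := by
      linear_combination d * h1 + (s * l - c) * h2
    rw [hd] at e'
    linear_combination (-1 : ZMod p) * e' - l * l * x 1 * hs
  have hll : l * l + l = 0 := by
    by_contra hne
    apply hx
    funext i
    fin_cases i
    · exact (mul_eq_zero.mp hsq0).resolve_left hne
    · exact (mul_eq_zero.mp hsq1).resolve_left hne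
  have : l * (l + 1) = 0 := by linear_combination hll
  rcases mul_eq_zero.mp this with h | h
  · exact absurd h hl
  · linear_combination h

end MatrixAlgebra

/-! ## §2 The Tate input over `ℚ`: a rational eigenvector of eigenvalue `± ℓ` for the restricted local Frobenius -/

section Tate

/-- **`χ_p(τ|_{ℚ̄}) = ℓ` for a local arithmetic Frobenius `τ ∈ Γ_{ℚ_ℓ}`** (`ℓ ≠ p`): the restriction
`σ₁ = resGalOfEmb ι τ` along `ι : ℚ̄ → ℚ̄_ℓ` is an arithmetic Frobenius at the prime `𝔓_{ι,𝔐} ∣ ℓ` of `ℤ̄`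
(`isArithFrobAt_resGalOfEmb`), so its mod-`p` cyclotomic character is the residue cardinality `ℓ`
(`modNCyclotomicCharacter_eq_residueCard_of_isArithFrobAt`). [cite: NeukirchANT1999, Ch. I (10.3), Ch. II (9.6)] -/
theorem modNCyclotomicCharacter_resGalOfEmb_eq_of_isArithFrobAt {v : HeightOneSpectrum (𝓞 ℚ)} {p ℓ : ℕ}
    [Fact p.Prime] (hv : (primesEquiv v : ℕ) = ℓ) (hℓp : ℓ ≠ p) {𝔐 : Ideal v.localAbsIntegers}
    (h𝔐 : 𝔐 ∈ v.localPrimesAbove) {τ : absoluteGaloisGroup (v.adicCompletion ℚ)}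
    (hτ : IsArithFrobAt (v.adicCompletionIntegers ℚ) τ 𝔐) :
    ((modNCyclotomicCharacter ℚ p (resGalOfEmb (closureEmb (K := ℚ) (v.adicCompletion ℚ)) τ) :
      (ZMod p)ˣ) : ZMod p) = (ℓ : ZMod p) := by
  have hp : p.Prime := Fact.out
  have hℓ : ℓ.Prime := hv ▸ (primesEquiv v).2
  haveI : NeZero p := ⟨hp.ne_zero⟩
  have h𝔓₁ : v.primeBelow (closureEmb (K := ℚ) (v.adicCompletion ℚ)) 𝔐 ∈ v.primesAbove :=
    primeBelow_mem_primesAbove h𝔐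
  rw [modNCyclotomicCharacter_eq_residueCard_of_isArithFrobAt (N := p) h𝔓₁ ?_
      (WeierstrassCurve.isArithFrobAt_resGalOfEmb h𝔐 _ hτ),
    ← natCard_residueField_eq_residueCard v, WeierstrassCurve.natCard_residueField_adicCompletionIntegers v, hv]
  refine Rat.natCast_not_mem_of_mem_primesAbove_of_not_dvd h𝔓₁ fun h => hℓp ?_
  rw [hv] at h
  exact (Nat.prime_dvd_prime_iff_eq hℓ hp).mp h

variable (W : WeierstrassCurve ℚ) [W.IsElliptic]

/-- **Tate: at a multiplicative place `v ∤ p`, the restriction `σ₁ = τ|_{ℚ̄}` of a local arithmetic Frobenius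
`τ ∈ Γ_{ℚ_v}` has a NON-ZERO `P ∈ W[p]` with `σ₁ • P = (± ℓ) • P`** (`ℓ = char v`). Proof: by the twisted Tate
uniformisation `Ψ : ℚ̄_v^× → W(ℚ̄_v)` (`σ • Ψ(u) = χ(σ) Ψ(σ u)`, `χ = ±1` the character of `ℚ_v(√γ)`, kernel `q^ℤ`;
Silverman *ATAEC* V.5.2 (c)–V.5.4, tree theorem `Silverman1994_thmV53_corV54_tateUniformisation_holds`) the point
`Ψ(ζ_p)` is `p`-torsion, non-zero (`ζ_p ∉ q^ℤ` as `|q| < 1`), and `τ • Ψ(ζ_p) = χ(τ) Ψ(ζ_p^{χ_p(σ₁)})` with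
`χ_p(σ₁) ≡ ℓ` (`σ₁` is an arithmetic Frobenius at `𝔓_{ι,𝔐}`: `isArithFrobAt_resGalOfEmb`,
`modNCyclotomicCharacter_eq_residueCard_of_isArithFrobAt`); transport to `W(ℚ̄)` along `ι_*`
(`exists_pointsMapOfEmb_eq_of_nsmul_eq_zero`, `pointsMapOfEmb_smul`).
[cite: SilvermanATAEC1994, Lemma V.5.2 (c), Thm. V.5.3, Cor. V.5.4 (PDF pp. 406–410), Thm. V.3.1 (c),(d)]
[cite: Serre1972, §1.11–§1.12] -/
theorem exists_eigenvector_resGalOfEmb_of_hasMultiplicativeReductionAt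
    {v : HeightOneSpectrum (𝓞 ℚ)} (hmult : W.HasMultiplicativeReductionAt v) {p ℓ : ℕ} (hp : p.Prime)
    (hv : (primesEquiv v : ℕ) = ℓ) (hℓp : ℓ ≠ p) {𝔐 : Ideal v.localAbsIntegers} (h𝔐 : 𝔐 ∈ v.localPrimesAbove)
    {τ : absoluteGaloisGroup (v.adicCompletion ℚ)}
    (hτ : IsArithFrobAt (v.adicCompletionIntegers ℚ) τ 𝔐) :
    ∃ s : ℤ, (s = 1 ∨ s = -1) ∧ ∃ P : geomTorsion W (p : ℤ), P ≠ 0 ∧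
      resGalOfEmb (closureEmb (K := ℚ) (v.adicCompletion ℚ)) τ • P = (s * (ℓ : ℤ)) • P := by
  haveI : NeZero p := ⟨hp.ne_zero⟩
  haveI : Fact p.Prime := ⟨hp⟩
  haveI : CharZero (AlgebraicClosure (v.adicCompletion ℚ)) :=
    charZero_of_injective_algebraMap (algebraMap ℚ (AlgebraicClosure (v.adicCompletion ℚ))).injective
  set ι := closureEmb (K := ℚ) (v.adicCompletion ℚ) with hι
  set σ₁ : absoluteGaloisGroup ℚ := resGalOfEmb ι τ with hσ₁
  -- a global primitive `p`-th root of unity; `σ₁ ζ = ζ^c` with `c ≡ ℓ (mod p)` (`σ₁` is a Frobenius at `𝔓_{ι,𝔐}`)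
  obtain ⟨ζ, hζ⟩ := HasEnoughRootsOfUnity.exists_primitiveRoot (AlgebraicClosure ℚ) p
  set c : ℕ := ((modNCyclotomicCharacter ℚ p σ₁ : (ZMod p)ˣ) : ZMod p).val with hc
  have hσζ : σ₁ • ζ = ζ ^ c := modNCyclotomicCharacter_spec ℚ p σ₁ ζ hζ.pow_eq_one
  have hcl : (c : ZMod p) = (ℓ : ZMod p) := by
    rw [hc, ZMod.natCast_zmod_val, hσ₁, hι, modNCyclotomicCharacter_resGalOfEmb_eq_of_isArithFrobAt hv hℓp h𝔐 hτ]
  -- the local root of unity `ζ' = ι ζ` and the action of `τ` on it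
  set ζ' : AlgebraicClosure (v.adicCompletion ℚ) := ι ζ with hζ'def
  have hζ' : IsPrimitiveRoot ζ' p := hζ.map_of_injective ι.injective
  have hζ'0 : ζ' ≠ 0 := hζ'.ne_zero hp.ne_zero
  set ζu : (AlgebraicClosure (v.adicCompletion ℚ))ˣ := Units.mk0 ζ' hζ'0 with hζu
  have hτζ : Field.absoluteGaloisGroup.toAlgEquiv (v.adicCompletion ℚ) τ ζ' = ζ' ^ c := by
    have h := apply_resGalAuxOfEmb_apply ι τ ζ
    change ι (σ₁ • ζ) = Field.absoluteGaloisGroup.toAlgEquiv (v.adicCompletion ℚ) τ ζ' at h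
    rw [← h, hσζ, map_pow]
  have hτζu : Units.map (Field.absoluteGaloisGroup.toAlgEquiv (v.adicCompletion ℚ) τ :
      AlgebraicClosure (v.adicCompletion ℚ) →* AlgebraicClosure (v.adicCompletion ℚ)) ζu = ζu ^ c :=
    Units.ext (by rw [Units.coe_map, MonoidHom.coe_coe, Units.val_pow_eq_pow_val, hζu, Units.val_mk0, hτζ])
  have hζup : ζu ^ p = 1 := Units.ext (by rw [Units.val_pow_eq_pow_val, hζu, Units.val_mk0, hζ'.pow_eq_one,
    Units.val_one])
  -- Tate's twisted uniformisation
  obtain ⟨q, t, Ψ, hq0, hq1, -, -, -, hker, hΨσ, -⟩ :=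
    TateCurve.Silverman1994_thmV53_corV54_tateUniformisation_holds W v hmult
  set P₁' : localPoints W (v.adicCompletion ℚ) := Ψ (Additive.ofMul ζu) with hP₁'
  have hpP₁' : p • P₁' = 0 := by
    rw [hP₁', ← map_nsmul, ← ofMul_pow, hζup, ofMul_one, map_zero]
  have hP₁'0 : P₁' ≠ 0 := by
    intro h0
    obtain ⟨n, hn⟩ := (hker ζu).mp h0
    have hq' : ‖q‖ < 1 := Valued.toNormedField.norm_lt_one_iff.mpr hq1
    have h1 : algebraMap (v.adicCompletion ℚ) (AlgebraicClosure (v.adicCompletion ℚ)) q ^ (n * p) = 1 := by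
      rw [_root_.zpow_mul, zpow_natCast, ← hn, hζu, Units.val_mk0, hζ'.pow_eq_one]
    have h2 := (TateCurve.zpow_algebraMap_eq_one_iff hq0 hq' _).mp h1
    have hn0 : n = 0 := by
      rcases mul_eq_zero.mp h2 with h | h
      · exact h
      · exact absurd h (by exact_mod_cast hp.ne_zero)
    rw [hn0, zpow_zero, hζu, Units.val_mk0] at hn
    exact hζ'.ne_one hp.one_lt hn
  -- `τ • P₁' = (sgn * c) • P₁'`
  set sgn : ℤ := if Field.absoluteGaloisGroup.toAlgEquiv (v.adicCompletion ℚ) τ t = t then 1 else -1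
    with hsgn
  have hsgn1 : sgn = 1 ∨ sgn = -1 := by
    rw [hsgn]; split_ifs
    · exact Or.inl rfl
    · exact Or.inr rfl
  have hτP : τ • P₁' = (sgn * c) • P₁' := by
    rw [hP₁', hΨσ τ ζu, hτζu, ofMul_pow, map_nsmul, mul_zsmul, natCast_zsmul]
  -- globalise along `ι_*`
  obtain ⟨P, hpP, hPP⟩ := exists_pointsMapOfEmb_eq_of_nsmul_eq_zero W ι hp.ne_zero hpP₁'
  have hPmem : P ∈ geomTorsion W (p : ℤ) := (Submodule.mem_torsionBy_iff _ _).mpr (by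
    change (p : ℤ) • P = 0; rw [natCast_zsmul, hpP])
  have hinj : Function.Injective (pointsMapOfEmb W ι) := pointsMapOfEmb_injective W ι
  -- `p ∣ ℓ - c`, so `c • P₁' = ℓ • P₁'`
  have hcP : (c : ℤ) • P₁' = (ℓ : ℤ) • P₁' := by
    have hdvd : (p : ℤ) ∣ (ℓ : ℤ) - (c : ℤ) := by
      rw [← ZMod.intCast_eq_intCast_iff_dvd_sub, Int.cast_natCast, Int.cast_natCast]
      exact hcl
    obtain ⟨k, hk⟩ := hdvd
    have hℓck : (ℓ : ℤ) = c + p * k := by linear_combination hk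
    rw [hℓck, add_zsmul, mul_comm, mul_zsmul, natCast_zsmul P₁' p, hpP₁', zsmul_zero, add_zero]
  refine ⟨sgn, hsgn1, ⟨P, hPmem⟩, fun h0 => hP₁'0 ?_, Subtype.ext ?_⟩
  · have hP0 : P = 0 := by simpa using congrArg Subtype.val h0
    rw [← hPP, hP0, map_zero]
  · rw [Literature.NumberTheory.EllipticCurves.AddSubgroup.torsionBy.coe_smul, AddSubgroupClass.coe_zsmul]
    change σ₁ • P = (sgn * (ℓ : ℤ)) • P
    apply hinj
    rw [hσ₁, pointsMapOfEmb_smul, hPP, hτP, map_zsmul, hPP, mul_zsmul, mul_zsmul, hcP]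

end Tate

end Summit.BirchSwinnertonDyer.BirchSwinnertonDyer.Theorems.EtaCartanField

end
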